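import Mathlib
import HarnessLib
import Summits.HubbardSuperconductivity.HubbardSuperconductivity.Theorems.KLProgrammeKLRegimeUVCovarianceWeightedRowsAt
import Summits.HubbardSuperconductivity.HubbardSuperconductivity.Theorems.KLProgrammeKLRegimeSectorSliceRowsMomentGeneric
import Summits.HubbardSuperconductivity.HubbardSuperconductivity.Theorems.KLProgrammeKLRegimeTwoVolumeProfileBridge
import Summits.HubbardSuperconductivity.HubbardSuperconductivity.Theorems.KLProgrammeKLRegimeTwoVolumeTorusBlocks

/-!
# Route `KLProgramme` — crux K3, child 4 VL (stmt-HubbardSuperconductivity-20440), located risk #8 «(VL)-DEAD-LEG»: the covariance data of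
# the UV-dressed propagator `C^K_{>Λ}` in the SPACE-TIME currency of the sectorised scales — plain position fields `ψ_{(x,σ,c)}`,
# `x ∈ SpaceTimeIdx V M` (`2M` imaginary times), i.e. the pull-back by `sectorSubMatrix V M β (trivialMultiplier V M)` — masses,
# `(1 + spaceTimeDist)`-weighted rows/columns and far TAILS, at every cutoff `0 < Λ ≤ klE0`, uniform in `L` and `M`

Cell gate-hubbard-kl, seat hubbard-kl-k3c4-p2 g10 (pen rulings (R59t)(ii)/(R59u)/(R59aa); BGM 2006 (4.8b)).  The source/dead legs of the
(α)-AUGMENTED ≡ (R-src) repair are PLAIN position-space legs on `SpaceTimeIdx V M` (k3c4-p1's `Γ_j ⊔ Src`, k3c5-p3's `P_V`); the dressing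
`C_{>Λ_j}` acts on them as `S₁ᵀ · C^K_{>Λ_j} · S₁`, `S₁ := sectorSubMatrix V M β (trivialMultiplier V M)`.  By k3c3-p2's generic reduction
`TorusFourierL2.rowSumWt_norm_pullback_normalCovariance_le` (any spin-free symbol `P(ω,k⃗)`, any even weight) its weighted rows are `8 ×` the
weighted torus sums of the character sum of the padded symbol `gridSymbol V M (2M) β (uvSymbolCT …)` — the grid currency of the companions
`…UVCovarianceMomentsAt / …SpaceMomentAt / …WeightedRowsAt` at `N = 2M`.  With `ε := imagTimeWeight β M = β/(2M)`, `FrameOK R U N_sc μ K`, `R.WF`,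
`|U| ≤ 1`, `klBetaMin ≤ β`, `β³ ≤ M`, cutoff derivatives `≤ B` up to order `5`, `0 < Λ ≤ klE0`:

* `hubbardCovAboveCT_eq_normalCovariance_freqFn`, `trivial_symbol_eq_gridSymbol` — the symbol bookkeeping;
* **`rowSumWt_spaceTime_uvCov_le`** / **`colSumWt_spaceTime_uvCov_le`** — GENERIC: weighted rows/columns `≤ 8·A` from a weighted torus-sum bound `A`;
* `torusSum_uvCov_le` — the plain torus sum `Σ_{a,b⃗} ‖S[G_σ]‖ ≤ (N/β)·A₀(Λ)` (any `N ≥ 2M`; the mass of the companions at the character-sum level);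
* **`rowSum_spaceTime_uvCov_le`** — `ε·Σ_{Y′} ‖(S₁ᵀ C S₁) Y Y′‖ ≤ 8·A₀(Λ)`;
* **`rowSum_spaceTime_uvCov_spaceTimeDist_le`** — `ε·Σ_{Y′} ‖(S₁ᵀ C S₁) Y Y′‖·(1 + spaceTimeDist (2M) ε 1 x x′) ≤ 8·(A₀(Λ) + uvTimeMomentConst Λ 7 32 + 2·X_R(Λ))`
  (`spaceTimeDist = ε·|Δt|_{2M} + |Δx⃗|_{ℓ^∞}`, `TorusLabelDistance`);
* **`farRowSum_spaceTime_uvCov_le`** — `ε·Σ_{Y′ : R < tnorm(x⃗ − x⃗′)} ‖(S₁ᵀ C S₁) Y Y′‖ ≤ 8·(A₀(Λ) + 2·X_R(Λ))/(R+1)` (tails → 0 uniformly in `L`, `M`);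
  and the column twins `colSum_spaceTime_uvCov_spaceTimeDist_le`, `farColSum_spaceTime_uvCov_le`.

Everything is proved; no definitions, no named facts.
-/

noncomputable section

namespace Summit.HubbardSuperconductivity.HubbardSuperconductivity.Theorems.UVCovarianceAt

set_option linter.dupNamespace false -- summit = problem name (single-conjunct summit), D-0017

open Real Finset Literature.MathematicalPhysics.QuantumLattice Literature.Probability.LatticeModels
open Literature.MathematicalPhysics.QuantumLattice.FermiRG
open Summit.HubbardSuperconductivity.HubbardSuperconductivity.Theorems.KLRegimeSplit
open Summit.HubbardSuperconductivity.HubbardSuperconductivity.Theorems.DispersionFlow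
open Summit.HubbardSuperconductivity.HubbardSuperconductivity.Theorems.ScaleZeroDecay
open Summit.HubbardSuperconductivity.HubbardSuperconductivity.Theorems.EngineV8
open Summit.HubbardSuperconductivity.HubbardSuperconductivity.Theorems.TwoVolumeDefect
open Summit.HubbardSuperconductivity.HubbardSuperconductivity.Theorems.TorusFourierL2

variable {L M : ℕ} [NeZero L] [NeZero M] {R : RenConsts} {U β μ Λ : ℝ} {Nsc : ℕ} {K : TrigPolyC4v} {B : ℝ}

/-! ## §1 Symbol bookkeeping -/

omit [NeZero M] in
/-- `C^K_{>Λ}` (seed `0`) is the normal covariance of the spin-free frequency function `(ω, k⃗) ↦ Ψ_{e_K(k⃗)}(ω)` read at the Matsubara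
frequencies (`0 < β`). -/
theorem hubbardCovAboveCT_eq_normalCovariance_freqFn (hβ : 0 < β) (μ : ℝ) (K : TrigPolyC4v) (Λ : ℝ) :
    hubbardCovAboveCT L M β μ 0 K Λ =
      normalCovariance L M (fun ks => (fun (ω : ℝ) (k : TorusSite 2 L) => uvSymbolFn (β * (L : ℝ) ^ 2) Λ (nambuXiCT L μ K k) ω)
        (matsubaraFreq β M ks.1.1) ks.1.2) := by
  rw [hubbardCovAboveCT_zero_seed_eq_normalCovariance_uvSymbolCT]
  congr 1
  funext ks
  obtain ⟨⟨i, k⟩, σ⟩ := ks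
  exact uvSymbolCT_eq_uvSymbolFn hβ μ K Λ i k σ

/-- At the trivial family the product-torus function of `rowSumWt_norm_pullback_normalCovariance_le` IS the padded UV symbol on the `2M`-grid
(both sides read at any spin `σ`: the symbol is spin-free). -/
theorem trivial_symbol_eq_gridSymbol (hβ : 0 < β) (μ : ℝ) (K : TrigPolyC4v) (Λ : ℝ) (σ : Fin 2) (ω ω' : Fin 1)
    (q₀ : TorusSite 1 (2 * M)) (qv : TorusSite 2 L) :
    ((1 / (β * (L : ℝ) ^ 2) : ℝ) : ℂ) ^ 2 *
        (trivialMultiplier L M ω (⟨(q₀ 0).val, ZMod.val_lt (q₀ 0)⟩, qv) * trivialMultiplier L M ω' (⟨(q₀ 0).val, ZMod.val_lt (q₀ 0)⟩, qv) *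
          uvSymbolFn (β * (L : ℝ) ^ 2) Λ (nambuXiCT L μ K qv) (matsubaraFreq β M ⟨(q₀ 0).val, ZMod.val_lt (q₀ 0)⟩)) =
      gridSymbol L M (2 * M) β (uvSymbolCT L M β μ K Λ) σ q₀ qv := by
  rw [gridSymbol_uvSymbolCT_eq hβ, if_pos (ZMod.val_lt (q₀ 0)), ← matsubaraFreq_eq_gridFreq β q₀ (ZMod.val_lt (q₀ 0))]
  simp [trivialMultiplier]

/-! ## §2 Generic: weighted rows / columns of `S₁ᵀ C^K_{>Λ} S₁` from weighted torus sums -/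

/-- **Weighted rows of the plain position-space pull-back** `S₁ᵀ C^K_{>Λ} S₁` (`S₁ = sectorSubMatrix … trivialMultiplier`): for every even weight
`w ≥ 0` on `(ℤ/2M) × (ℤ/L)²`, if `Σ_{a,b⃗} w(a,b⃗)·‖S[G_σ](a,b⃗)‖ ≤ A` for both spins, then `Σ_{Y′} ‖(S₁ᵀCS₁) Y Y′‖·w(x − x′) ≤ 8·A`. -/
theorem rowSumWt_spaceTime_uvCov_le (hβ : 0 < β) (w : TorusSite 1 (2 * M) × TorusSite 2 L → ℝ) (hw0 : ∀ z, 0 ≤ w z)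
    (hw : ∀ a b, w (-a, -b) = w (a, b)) {A : ℝ}
    (hA : ∀ σ : Fin 2, ∑ a : TorusSite 1 (2 * M), ∑ bv : TorusSite 2 L,
      w (a, bv) * ‖∑ q₀ : TorusSite 1 (2 * M), ∑ qv : TorusSite 2 L, torusChar q₀ a * torusChar qv bv *
        gridSymbol L M (2 * M) β (uvSymbolCT L M β μ K Λ) σ q₀ qv‖ ≤ A)
    (Y : SpaceTimeIdx L M × SectorLeg 1) :
    ∑ Y' : SpaceTimeIdx L M × SectorLeg 1,
        ‖((sectorSubMatrix L M β (trivialMultiplier L M)).transpose * hubbardCovAboveCT L M β μ 0 K Λ *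
            sectorSubMatrix L M β (trivialMultiplier L M)) Y Y'‖ *
          w ((fun _ : Fin 1 => ((Y.1.1 : ℕ) : ZMod (2 * M)) - ((Y'.1.1 : ℕ) : ZMod (2 * M))), Y.1.2 - Y'.1.2) ≤ 8 * A := by
  set P : ℝ → TorusSite 2 L → ℂ := fun ω k => uvSymbolFn (β * (L : ℝ) ^ 2) Λ (nambuXiCT L μ K k) ω with hP
  rw [hubbardCovAboveCT_eq_normalCovariance_freqFn hβ]
  refine (rowSumWt_norm_pullback_normalCovariance_le hβ.ne' P (trivialMultiplier L M) w hw0 hw Y).trans ?_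
  rw [Fin.sum_univ_one]
  refine mul_le_mul_of_nonneg_left (le_of_eq_of_le ?_ (hA Y.2.1.2)) (by norm_num)
  rw [Fintype.sum_prod_type]
  refine sum_congr rfl fun a _ => sum_congr rfl fun bv _ => ?_
  congr 2
  rw [Fintype.sum_prod_type]
  refine sum_congr rfl fun q₀ _ => sum_congr rfl fun qv _ => ?_
  rw [smul_eq_mul, hP, trivial_symbol_eq_gridSymbol hβ μ K Λ Y.2.1.2 Y.2.1.1 0 q₀ qv]

/-- **Weighted columns** of `S₁ᵀ C^K_{>Λ} S₁` from the same torus-sum bound: `Σ_{Y} ‖(S₁ᵀCS₁) Y Y′‖·w(x − x′) ≤ 8·A`. -/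
theorem colSumWt_spaceTime_uvCov_le (hβ : 0 < β) (w : TorusSite 1 (2 * M) × TorusSite 2 L → ℝ) (hw0 : ∀ z, 0 ≤ w z)
    (hw : ∀ a b, w (-a, -b) = w (a, b)) {A : ℝ}
    (hA : ∀ σ : Fin 2, ∑ a : TorusSite 1 (2 * M), ∑ bv : TorusSite 2 L,
      w (a, bv) * ‖∑ q₀ : TorusSite 1 (2 * M), ∑ qv : TorusSite 2 L, torusChar q₀ a * torusChar qv bv *
        gridSymbol L M (2 * M) β (uvSymbolCT L M β μ K Λ) σ q₀ qv‖ ≤ A)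
    (Y' : SpaceTimeIdx L M × SectorLeg 1) :
    ∑ Y : SpaceTimeIdx L M × SectorLeg 1,
        ‖((sectorSubMatrix L M β (trivialMultiplier L M)).transpose * hubbardCovAboveCT L M β μ 0 K Λ *
            sectorSubMatrix L M β (trivialMultiplier L M)) Y Y'‖ *
          w ((fun _ : Fin 1 => ((Y.1.1 : ℕ) : ZMod (2 * M)) - ((Y'.1.1 : ℕ) : ZMod (2 * M))), Y.1.2 - Y'.1.2) ≤ 8 * A := by
  set P : ℝ → TorusSite 2 L → ℂ := fun ω k => uvSymbolFn (β * (L : ℝ) ^ 2) Λ (nambuXiCT L μ K k) ω with hP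
  rw [hubbardCovAboveCT_eq_normalCovariance_freqFn hβ]
  refine (colSumWt_norm_pullback_normalCovariance_le hβ.ne' P (trivialMultiplier L M) w hw0 hw Y').trans ?_
  rw [Fin.sum_univ_one]
  refine mul_le_mul_of_nonneg_left (le_of_eq_of_le ?_ (hA Y'.2.1.2)) (by norm_num)
  rw [Fintype.sum_prod_type]
  refine sum_congr rfl fun a _ => sum_congr rfl fun bv _ => ?_
  congr 2
  rw [Fintype.sum_prod_type]
  refine sum_congr rfl fun q₀ _ => sum_congr rfl fun qv _ => ?_
  rw [smul_eq_mul, hP, trivial_symbol_eq_gridSymbol hβ μ K Λ Y'.2.1.2 0 Y'.2.1.1 q₀ qv]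

/-! ## §3 The plain torus sum (mass at the character-sum level), any grid `N ≥ 2M` -/

omit [NeZero M] in
/-- **The mass at the character-sum level**: `Σ_{a,b⃗} ‖S[G_σ](a,b⃗)‖ ≤ (N/β)·A₀(Λ)` for an admissible frame, `klBetaMin ≤ β`, `β³ ≤ M`, `2M ≤ N`,
`0 < Λ ≤ klE0` (the torus sum behind `rowSum_uvCov_le`). -/
theorem torusSum_uvCov_le {N : ℕ} [NeZero N] (hK : FrameOK R U Nsc μ K) (hβ : klBetaMin ≤ β) (hβM : β ^ 3 ≤ (M : ℝ)) (hΛ : 0 < Λ)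
    (hΛe : Λ ≤ klE0) (hMN : 2 * M ≤ N) (σ : Fin 2) :
    ∑ a : TorusSite 1 N, ∑ bv : TorusSite 2 L,
        ‖∑ q₀ : TorusSite 1 N, ∑ qv : TorusSite 2 L, torusChar q₀ a * torusChar qv bv * gridSymbol L M N β (uvSymbolCT L M β μ K Λ) σ q₀ qv‖ ≤
      (N : ℝ) / β * (14 * Real.sqrt ((1 / 2 + 12 / Λ) *
        (2 / Λ + 128 * Real.pi ^ 4 * (4 * (1110 : ℝ) + 6 * (32 / 3) + 2) ^ 2 / Λ +
          2 * Real.pi ^ 5 * (4 * (1110 : ℝ) + 6 * (32 / 3) + 2) ^ 2 / Λ ^ 2 + 1 +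
          Real.pi ^ 4 * ((7 : ℝ) ^ 2 * (4 * (1110 : ℝ) + 6 * (32 / 3) + 2) * (2 / Λ) + 7 * (2 * (32 / 3) + 1)) ^ 2 / Λ ^ 3))) := by
  have hβ0 : 0 < β := beta_pos_of_klBetaMin_le hβ
  have hβ128 : (128 : ℝ) ≤ β := by simpa [klBetaMin] using hβ
  have hβ3 : β ≤ β ^ 3 := by nlinarith [sq_nonneg β]
  have hMr : β ≤ (M : ℝ) := hβ3.trans hβM
  have hM2 : 2 ≤ M := by
    have : (2 : ℝ) ≤ M := by linarith
    exact_mod_cast this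
  have hNr : 2 * (M : ℝ) ≤ N := by exact_mod_cast hMN
  have hN0 : 0 < (N : ℝ) := by linarith
  have hs₀pos : 0 < β * Λ / N := by positivity
  have hsum := sum_sum_norm_charSum_gridSymbol_uvSymbolCT_le (L := L) hβ0 hΛ klsv_B₁ klsv_B₂ (by norm_num) (uvLineBound_of_frameOK hK) hM2 hMN hs₀pos σ
  have h := mul_le_fourteen_sqrt_of_le hsum (by positivity) (by positivity : (0 : ℝ) ≤ β / N)
    (radicand_uvCov_le (L := L) hβ klsv_B₁ klsv_B₂ hβM hΛ hΛe hMN)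
  rw [div_mul_eq_mul_div, div_le_iff₀ hN0] at h
  rw [div_mul_eq_mul_div, le_div_iff₀ hβ0]
  linarith

/-! ## §4 The KL-regime rows, weighted rows and tails in the space-time currency -/

section Regime

/-- `ε·(2M/β) = 1` (`β ≠ 0`, `M ≠ 0`). -/
theorem imagTimeWeight_mul_twoM_div (hβ : β ≠ 0) : imagTimeWeight β M * ((((2 * M : ℕ)) : ℝ) / β) = 1 := by
  have hM : (M : ℝ) ≠ 0 := by exact_mod_cast NeZero.ne M
  unfold imagTimeWeight
  push_cast
  field_simp

/-- **Mass, space-time currency**: `ε·Σ_{Y′} ‖(S₁ᵀ C^K_{>Λ} S₁) Y Y′‖ ≤ 8·A₀(Λ)`. -/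
theorem rowSum_spaceTime_uvCov_le (hK : FrameOK R U Nsc μ K) (hβ : klBetaMin ≤ β) (hβM : β ^ 3 ≤ (M : ℝ)) (hΛ : 0 < Λ) (hΛe : Λ ≤ klE0)
    (Y : SpaceTimeIdx L M × SectorLeg 1) :
    imagTimeWeight β M * ∑ Y' : SpaceTimeIdx L M × SectorLeg 1,
        ‖((sectorSubMatrix L M β (trivialMultiplier L M)).transpose * hubbardCovAboveCT L M β μ 0 K Λ *
            sectorSubMatrix L M β (trivialMultiplier L M)) Y Y'‖ ≤
      8 * (14 * Real.sqrt ((1 / 2 + 12 / Λ) *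
        (2 / Λ + 128 * Real.pi ^ 4 * (4 * (1110 : ℝ) + 6 * (32 / 3) + 2) ^ 2 / Λ +
          2 * Real.pi ^ 5 * (4 * (1110 : ℝ) + 6 * (32 / 3) + 2) ^ 2 / Λ ^ 2 + 1 +
          Real.pi ^ 4 * ((7 : ℝ) ^ 2 * (4 * (1110 : ℝ) + 6 * (32 / 3) + 2) * (2 / Λ) + 7 * (2 * (32 / 3) + 1)) ^ 2 / Λ ^ 3))) := by
  have hβ0 : 0 < β := beta_pos_of_klBetaMin_le hβ
  set A0 : ℝ := 14 * Real.sqrt ((1 / 2 + 12 / Λ) *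
        (2 / Λ + 128 * Real.pi ^ 4 * (4 * (1110 : ℝ) + 6 * (32 / 3) + 2) ^ 2 / Λ +
          2 * Real.pi ^ 5 * (4 * (1110 : ℝ) + 6 * (32 / 3) + 2) ^ 2 / Λ ^ 2 + 1 +
          Real.pi ^ 4 * ((7 : ℝ) ^ 2 * (4 * (1110 : ℝ) + 6 * (32 / 3) + 2) * (2 / Λ) + 7 * (2 * (32 / 3) + 1)) ^ 2 / Λ ^ 3)) with hA0
  have hA : ∀ σ : Fin 2, ∑ a : TorusSite 1 (2 * M), ∑ bv : TorusSite 2 L,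
      (fun _ : TorusSite 1 (2 * M) × TorusSite 2 L => (1 : ℝ)) (a, bv) *
        ‖∑ q₀ : TorusSite 1 (2 * M), ∑ qv : TorusSite 2 L, torusChar q₀ a * torusChar qv bv *
          gridSymbol L M (2 * M) β (uvSymbolCT L M β μ K Λ) σ q₀ qv‖ ≤ (((2 * M : ℕ)) : ℝ) / β * A0 := by
    intro σ
    refine le_of_eq_of_le (sum_congr rfl fun a _ => sum_congr rfl fun bv _ => one_mul _) ?_
    exact torusSum_uvCov_le (L := L) (N := 2 * M) hK hβ hβM hΛ hΛe le_rfl σ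
  have h := rowSumWt_spaceTime_uvCov_le (L := L) (M := M) (μ := μ) (K := K) (Λ := Λ) hβ0 (fun _ => (1 : ℝ)) (fun _ => zero_le_one)
    (fun _ _ => rfl) hA Y
  replace h := le_of_eq_of_le (sum_congr rfl fun Y' _ => (mul_one _).symm) h
  calc imagTimeWeight β M * ∑ Y' : SpaceTimeIdx L M × SectorLeg 1,
        ‖((sectorSubMatrix L M β (trivialMultiplier L M)).transpose * hubbardCovAboveCT L M β μ 0 K Λ *
            sectorSubMatrix L M β (trivialMultiplier L M)) Y Y'‖
      ≤ imagTimeWeight β M * (8 * ((((2 * M : ℕ)) : ℝ) / β * A0)) :=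
        mul_le_mul_of_nonneg_left h (imagTimeWeight_nonneg hβ0.le M)
    _ = 8 * A0 := by
        have h1 := imagTimeWeight_mul_twoM_div (M := M) hβ0.ne'
        calc imagTimeWeight β M * (8 * ((((2 * M : ℕ)) : ℝ) / β * A0))
            = 8 * A0 * (imagTimeWeight β M * ((((2 * M : ℕ)) : ℝ) / β)) := by ring
          _ = 8 * A0 := by rw [h1, mul_one]

/-- The weighted torus sum against `1 + ε|ã|_{2M} + |b̃|_{ℓ^∞}` (plain + time + space). -/
theorem torusSum_uvCov_spaceTimeWt_le (hK : FrameOK R U Nsc μ K) (hR : R.WF) (hU1 : |U| ≤ 1) (hβ : klBetaMin ≤ β) (hβM : β ^ 3 ≤ (M : ℝ))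
    (hB1 : 1 ≤ B) (hB : ∀ i ≤ 5, ∀ t, ‖iteratedDeriv i salmhoferCutoff t‖ ≤ B) (hΛ : 0 < Λ) (hΛe : Λ ≤ klE0) (σ : Fin 2) :
    ∑ a : TorusSite 1 (2 * M), ∑ bv : TorusSite 2 L,
        (1 + (imagTimeWeight β M * cyclicDist (2 * M) (a 0) 0 + torusSiteDist bv 0)) *
          ‖∑ q₀ : TorusSite 1 (2 * M), ∑ qv : TorusSite 2 L, torusChar q₀ a * torusChar qv bv *
            gridSymbol L M (2 * M) β (uvSymbolCT L M β μ K Λ) σ q₀ qv‖ ≤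
      (((2 * M : ℕ)) : ℝ) / β *
        (14 * Real.sqrt ((1 / 2 + 12 / Λ) *
            (2 / Λ + 128 * Real.pi ^ 4 * (4 * (1110 : ℝ) + 6 * (32 / 3) + 2) ^ 2 / Λ +
              2 * Real.pi ^ 5 * (4 * (1110 : ℝ) + 6 * (32 / 3) + 2) ^ 2 / Λ ^ 2 + 1 +
              Real.pi ^ 4 * ((7 : ℝ) ^ 2 * (4 * (1110 : ℝ) + 6 * (32 / 3) + 2) * (2 / Λ) + 7 * (2 * (32 / 3) + 1)) ^ 2 / Λ ^ 3)) +
          uvTimeMomentConst Λ 7 32 +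
          2 * (uvSpaceMomentConst Λ 1 (uvPieceSq Λ (uvBaseQ B Λ 4) (uvBaseQ' B Λ 4)) +
            (1 / 4 * Real.sqrt (216 * (1 / Λ + 1 / 2)) *
                ∑ e : Fin 2 × Fin 2, (uvLinV Λ (1 + (e.1 : ℕ) + (e.2 : ℕ)) *
                    (B * ((1 + ((e.1 : ℕ) + (e.2 : ℕ)) + 2).factorial : ℝ) * (4 / Λ) ^ (1 + ((e.1 : ℕ) + (e.2 : ℕ)) + 1)) +
                  uvLinD Λ (1 + (e.1 : ℕ) + (e.2 : ℕ)) *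
                    (B * ((1 + ((e.1 : ℕ) + (e.2 : ℕ)) + 3).factorial : ℝ) * (4 / Λ) ^ (1 + ((e.1 : ℕ) + (e.2 : ℕ)) + 2)))) *
              (4608 * (1 + R.Gfr 0 + R.Gfr 1 + R.Gfr 2 + R.Gfr 3) ^ 4 * (((Nsc : ℝ) + 1) * U ^ 2 + 2 * |U|)))) := by
  have hβ0 : 0 < β := beta_pos_of_klBetaMin_le hβ
  have hN0 : 0 < ((((2 * M : ℕ)) : ℝ)) := by have := NeZero.ne M; positivity
  set A0 : ℝ := 14 * Real.sqrt ((1 / 2 + 12 / Λ) *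
        (2 / Λ + 128 * Real.pi ^ 4 * (4 * (1110 : ℝ) + 6 * (32 / 3) + 2) ^ 2 / Λ +
          2 * Real.pi ^ 5 * (4 * (1110 : ℝ) + 6 * (32 / 3) + 2) ^ 2 / Λ ^ 2 + 1 +
          Real.pi ^ 4 * ((7 : ℝ) ^ 2 * (4 * (1110 : ℝ) + 6 * (32 / 3) + 2) * (2 / Λ) + 7 * (2 * (32 / 3) + 1)) ^ 2 / Λ ^ 3)) with hA0
  set XR : ℝ := uvSpaceMomentConst Λ 1 (uvPieceSq Λ (uvBaseQ B Λ 4) (uvBaseQ' B Λ 4)) +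
            (1 / 4 * Real.sqrt (216 * (1 / Λ + 1 / 2)) *
                ∑ e : Fin 2 × Fin 2, (uvLinV Λ (1 + (e.1 : ℕ) + (e.2 : ℕ)) *
                    (B * ((1 + ((e.1 : ℕ) + (e.2 : ℕ)) + 2).factorial : ℝ) * (4 / Λ) ^ (1 + ((e.1 : ℕ) + (e.2 : ℕ)) + 1)) +
                  uvLinD Λ (1 + (e.1 : ℕ) + (e.2 : ℕ)) *
                    (B * ((1 + ((e.1 : ℕ) + (e.2 : ℕ)) + 3).factorial : ℝ) * (4 / Λ) ^ (1 + ((e.1 : ℕ) + (e.2 : ℕ)) + 2)))) *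
              (4608 * (1 + R.Gfr 0 + R.Gfr 1 + R.Gfr 2 + R.Gfr 3) ^ 4 * (((Nsc : ℝ) + 1) * U ^ 2 + 2 * |U|)) with hXR
  set S : TorusSite 1 (2 * M) → TorusSite 2 L → ℝ := fun a bv => ‖∑ q₀ : TorusSite 1 (2 * M), ∑ qv : TorusSite 2 L,
    torusChar q₀ a * torusChar qv bv * gridSymbol L M (2 * M) β (uvSymbolCT L M β μ K Λ) σ q₀ qv‖ with hS
  have hplain : ∑ a : TorusSite 1 (2 * M), ∑ bv : TorusSite 2 L, S a bv ≤ ((((2 * M : ℕ)) : ℝ)) / β * A0 :=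
    torusSum_uvCov_le (L := L) (N := 2 * M) hK hβ hβM hΛ hΛe le_rfl σ
  have htime : ∑ a : TorusSite 1 (2 * M), ∑ bv : TorusSite 2 L, imagTimeWeight β M * cyclicDist (2 * M) (a 0) 0 * S a bv ≤
      ((((2 * M : ℕ)) : ℝ)) / β * uvTimeMomentConst Λ 7 32 := by
    have h := timeMoment_uvCov_of_frameOK (L := L) (N := 2 * M) hK hβ hβM le_rfl hΛ (Rs := 32) (by norm_num) σ
    have hε : imagTimeWeight β M = β / ((((2 * M : ℕ)) : ℝ)) := by unfold imagTimeWeight; push_cast; ring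
    simp_rw [cyclicDist_zero_eq_abs_valMinAbs, hε]
    rw [show ((((2 * M : ℕ)) : ℝ)) / β * uvTimeMomentConst Λ 7 32 = (β / ((((2 * M : ℕ)) : ℝ)))⁻¹ * uvTimeMomentConst Λ 7 32 by rw [inv_div]]
    exact (le_inv_mul_iff₀ (by positivity)).2 h
  have hspace : ∑ a : TorusSite 1 (2 * M), ∑ bv : TorusSite 2 L, torusSiteDist bv 0 * S a bv ≤ ((((2 * M : ℕ)) : ℝ)) / β * (2 * XR) :=
    torusSum_uvCov_spaceWt_le (L := L) (N := 2 * M) hK hR hU1 hβ hβM le_rfl hB1 hB hΛ hΛe σ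
  have hsplit : ∀ a bv, (1 + (imagTimeWeight β M * cyclicDist (2 * M) (a 0) 0 + torusSiteDist bv 0)) * S a bv =
      S a bv + imagTimeWeight β M * cyclicDist (2 * M) (a 0) 0 * S a bv + torusSiteDist bv 0 * S a bv := fun a bv => by ring
  show ∑ a : TorusSite 1 (2 * M), ∑ bv : TorusSite 2 L,
      (1 + (imagTimeWeight β M * cyclicDist (2 * M) (a 0) 0 + torusSiteDist bv 0)) * S a bv ≤ _
  simp_rw [hsplit, sum_add_distrib]
  rw [mul_add, mul_add]
  exact add_le_add (add_le_add hplain htime) hspace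

/-- **`(1 + spaceTimeDist)`-weighted rows, space-time currency**:
`ε·Σ_{Y′} ‖(S₁ᵀ C^K_{>Λ} S₁) Y Y′‖·(1 + spaceTimeDist (2M) ε 1 x x′) ≤ 8·(A₀(Λ) + uvTimeMomentConst Λ 7 32 + 2·X_R(Λ))`. -/
theorem rowSum_spaceTime_uvCov_spaceTimeDist_le (hK : FrameOK R U Nsc μ K) (hR : R.WF) (hU1 : |U| ≤ 1) (hβ : klBetaMin ≤ β)
    (hβM : β ^ 3 ≤ (M : ℝ)) (hB1 : 1 ≤ B) (hB : ∀ i ≤ 5, ∀ t, ‖iteratedDeriv i salmhoferCutoff t‖ ≤ B) (hΛ : 0 < Λ) (hΛe : Λ ≤ klE0)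
    (Y : SpaceTimeIdx L M × SectorLeg 1) :
    imagTimeWeight β M * ∑ Y' : SpaceTimeIdx L M × SectorLeg 1,
        ‖((sectorSubMatrix L M β (trivialMultiplier L M)).transpose * hubbardCovAboveCT L M β μ 0 K Λ *
            sectorSubMatrix L M β (trivialMultiplier L M)) Y Y'‖ *
          (1 + Literature.MathematicalPhysics.QuantumLattice.spaceTimeDist (2 * M) (imagTimeWeight β M) 1 Y.1 Y'.1) ≤
      8 * (14 * Real.sqrt ((1 / 2 + 12 / Λ) *
            (2 / Λ + 128 * Real.pi ^ 4 * (4 * (1110 : ℝ) + 6 * (32 / 3) + 2) ^ 2 / Λ +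
              2 * Real.pi ^ 5 * (4 * (1110 : ℝ) + 6 * (32 / 3) + 2) ^ 2 / Λ ^ 2 + 1 +
              Real.pi ^ 4 * ((7 : ℝ) ^ 2 * (4 * (1110 : ℝ) + 6 * (32 / 3) + 2) * (2 / Λ) + 7 * (2 * (32 / 3) + 1)) ^ 2 / Λ ^ 3)) +
          uvTimeMomentConst Λ 7 32 +
          2 * (uvSpaceMomentConst Λ 1 (uvPieceSq Λ (uvBaseQ B Λ 4) (uvBaseQ' B Λ 4)) +
            (1 / 4 * Real.sqrt (216 * (1 / Λ + 1 / 2)) *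
                ∑ e : Fin 2 × Fin 2, (uvLinV Λ (1 + (e.1 : ℕ) + (e.2 : ℕ)) *
                    (B * ((1 + ((e.1 : ℕ) + (e.2 : ℕ)) + 2).factorial : ℝ) * (4 / Λ) ^ (1 + ((e.1 : ℕ) + (e.2 : ℕ)) + 1)) +
                  uvLinD Λ (1 + (e.1 : ℕ) + (e.2 : ℕ)) *
                    (B * ((1 + ((e.1 : ℕ) + (e.2 : ℕ)) + 3).factorial : ℝ) * (4 / Λ) ^ (1 + ((e.1 : ℕ) + (e.2 : ℕ)) + 2)))) *
              (4608 * (1 + R.Gfr 0 + R.Gfr 1 + R.Gfr 2 + R.Gfr 3) ^ 4 * (((Nsc : ℝ) + 1) * U ^ 2 + 2 * |U|)))) := by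
  have hβ0 : 0 < β := beta_pos_of_klBetaMin_le hβ
  set Tot : ℝ := 14 * Real.sqrt ((1 / 2 + 12 / Λ) *
            (2 / Λ + 128 * Real.pi ^ 4 * (4 * (1110 : ℝ) + 6 * (32 / 3) + 2) ^ 2 / Λ +
              2 * Real.pi ^ 5 * (4 * (1110 : ℝ) + 6 * (32 / 3) + 2) ^ 2 / Λ ^ 2 + 1 +
              Real.pi ^ 4 * ((7 : ℝ) ^ 2 * (4 * (1110 : ℝ) + 6 * (32 / 3) + 2) * (2 / Λ) + 7 * (2 * (32 / 3) + 1)) ^ 2 / Λ ^ 3)) +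
          uvTimeMomentConst Λ 7 32 +
          2 * (uvSpaceMomentConst Λ 1 (uvPieceSq Λ (uvBaseQ B Λ 4) (uvBaseQ' B Λ 4)) +
            (1 / 4 * Real.sqrt (216 * (1 / Λ + 1 / 2)) *
                ∑ e : Fin 2 × Fin 2, (uvLinV Λ (1 + (e.1 : ℕ) + (e.2 : ℕ)) *
                    (B * ((1 + ((e.1 : ℕ) + (e.2 : ℕ)) + 2).factorial : ℝ) * (4 / Λ) ^ (1 + ((e.1 : ℕ) + (e.2 : ℕ)) + 1)) +
                  uvLinD Λ (1 + (e.1 : ℕ) + (e.2 : ℕ)) *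
                    (B * ((1 + ((e.1 : ℕ) + (e.2 : ℕ)) + 3).factorial : ℝ) * (4 / Λ) ^ (1 + ((e.1 : ℕ) + (e.2 : ℕ)) + 2)))) *
              (4608 * (1 + R.Gfr 0 + R.Gfr 1 + R.Gfr 2 + R.Gfr 3) ^ 4 * (((Nsc : ℝ) + 1) * U ^ 2 + 2 * |U|))) with hTot
  set w : TorusSite 1 (2 * M) × TorusSite 2 L → ℝ := fun z => 1 + (imagTimeWeight β M * cyclicDist (2 * M) (z.1 0) 0 + torusSiteDist z.2 0)
    with hw
  have hw0 : ∀ z, 0 ≤ w z := fun z => by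
    have h1 : (0 : ℝ) ≤ cyclicDist (2 * M) (z.1 0) 0 := by rw [cyclicDist_zero_eq_abs_valMinAbs]; exact abs_nonneg _
    have h2 : (0 : ℝ) ≤ torusSiteDist z.2 0 := isLabelDist_torusSiteDist.nonneg _ _
    have h3 := imagTimeWeight_nonneg hβ0.le M
    simp only [hw]
    positivity
  have hweven : ∀ a b, w (-a, -b) = w (a, b) := fun a b => by
    simp only [hw, Pi.neg_apply, cyclicDist_neg_zero, torusSiteDist_neg_zero]
  have hA : ∀ σ : Fin 2, ∑ a : TorusSite 1 (2 * M), ∑ bv : TorusSite 2 L, w (a, bv) *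
      ‖∑ q₀ : TorusSite 1 (2 * M), ∑ qv : TorusSite 2 L, torusChar q₀ a * torusChar qv bv *
        gridSymbol L M (2 * M) β (uvSymbolCT L M β μ K Λ) σ q₀ qv‖ ≤ ((((2 * M : ℕ)) : ℝ)) / β * Tot := fun σ =>
    torusSum_uvCov_spaceTimeWt_le (L := L) hK hR hU1 hβ hβM hB1 hB hΛ hΛe σ
  have h := rowSumWt_spaceTime_uvCov_le (L := L) (M := M) (μ := μ) (K := K) (Λ := Λ) hβ0 w hw0 hweven hA Y
  -- identify the weight with `1 + spaceTimeDist`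
  have hwt : ∀ Y' : SpaceTimeIdx L M × SectorLeg 1,
      w ((fun _ : Fin 1 => ((Y.1.1 : ℕ) : ZMod (2 * M)) - ((Y'.1.1 : ℕ) : ZMod (2 * M))), Y.1.2 - Y'.1.2) =
        1 + Literature.MathematicalPhysics.QuantumLattice.spaceTimeDist (2 * M) (imagTimeWeight β M) 1 Y.1 Y'.1 := by
    intro Y'
    have hc : ∀ a b : ZMod (2 * M), cyclicDist (2 * M) a b = cyclicDist (2 * M) (a - b) 0 := fun a b => by simp [cyclicDist]
    simp only [hw, Literature.MathematicalPhysics.QuantumLattice.spaceTimeDist, finCyclicDist, one_mul]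
    rw [← hc, ← torusSiteDist_eq_sub_zero]
  simp_rw [hwt] at h
  calc _ ≤ imagTimeWeight β M * (8 * (((((2 * M : ℕ)) : ℝ)) / β * Tot)) := mul_le_mul_of_nonneg_left h (imagTimeWeight_nonneg hβ0.le M)
    _ = 8 * Tot := by
        have h1 := imagTimeWeight_mul_twoM_div (M := M) hβ0.ne'
        calc imagTimeWeight β M * (8 * (((((2 * M : ℕ)) : ℝ)) / β * Tot)) = 8 * Tot * (imagTimeWeight β M * ((((2 * M : ℕ)) : ℝ) / β)) := by ring
          _ = 8 * Tot := by rw [h1, mul_one]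

end Regime

end Summit.HubbardSuperconductivity.HubbardSuperconductivity.Theorems.UVCovarianceAt

end
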